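import Mathlib
import Summits.Ventures.HodgeRepro.Tier4.Common.AdelicDefs
import Summits.Ventures.HodgeRepro.Tier4.Line1.C7Components

/-!
# Tier4/Line1/C7CompactBox — (C7.3a) every compact subset of `𝔸_k⁴` lies in a box

Blind re-derivation cell `pub-hodge-repro`, Tier 4 (README §9–§10), seat t4-L1-p2 (prover, LINE L1, gen 0).
Rung C7.3a of t4-L1-p4's typed census of the fibration wall C7 (`proofs/t4/L1/C7-rungs-sig.lean` L151–L163, S12903;
assignment S12903/S12946): a compact `C₀ ⊆ 𝔸_k⁴` lies in `∏_w C_w × ∏_{v ∈ S} C_v × ∏_{v ∉ S} 𝓞_v⁴` with `S` finite and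
every `C_w`, `C_v` compact.  PROOF: the finite adeles `𝔸_{k,f} = Πʳ_v [k_v, 𝓞_v]` are covered by the OPEN subgroups
`U_S = {f : f_v ∈ 𝓞_v for all v ∉ S}`, `S` finite (`RestrictedProduct.isOpen_forall_imp_mem`, `𝓞_v` open); a compact
set meets finitely many of them, and `U_{S₁} ∪ … ∪ U_{S_n} ⊆ U_{S₁ ∪ … ∪ S_n}`; the four coordinates give four finite
sets, `S` their union; `C_v := finVec v '' C₀`, `C_w := infVec w '' C₀` are continuous images of `C₀`.  Statement
verbatim from the census; components `finVec`, `infVec` are p4's (`Tier4/Line1/C7Components.lean`).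
HC_CM is NOT proved by anyone in this repository.
-/

set_option autoImplicit false

noncomputable section

namespace Summit.Ventures.HodgeRepro.Tier4.Line1

open NumberField IsDedekindDomain HeightOneSpectrum Topology Common Set

section CompactBox

variable {k : Type} [Field k] [NumberField k]

open scoped RestrictedProduct in
/-- **a compact subset of the finite adeles is integral outside a finite set of places**: the open subgroups
`U_S = {f : f v ∈ 𝓞_v ∀ v ∉ S}` (`S` finite) cover `𝔸_{k,f}` and increase with `S`. -/
theorem exists_finset_forall_mem_integers_of_isCompact {C : Set (FiniteAdeleRing (𝓞 k) k)}
    (hC : IsCompact C) :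
    ∃ S : Finset (HeightOneSpectrum (𝓞 k)), ∀ x ∈ C, ∀ v ∉ S, x v ∈ v.adicCompletionIntegers k := by
  classical
  have hAopen : ∀ v : HeightOneSpectrum (𝓞 k),
      IsOpen (v.adicCompletionIntegers k : Set (v.adicCompletion k)) :=
    fun v => Valued.isOpen_valuationSubring _
  let U : Finset (HeightOneSpectrum (𝓞 k)) → Set (FiniteAdeleRing (𝓞 k) k) :=
    fun S => {f | ∀ v, v ∉ S → f v ∈ v.adicCompletionIntegers k}
  have hUo : ∀ S, IsOpen (U S) := fun S =>
    RestrictedProduct.isOpen_forall_imp_mem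
      (R := fun v : HeightOneSpectrum (𝓞 k) => v.adicCompletion k)
      (A := fun v => (v.adicCompletionIntegers k : Set (v.adicCompletion k))) hAopen (p := fun v => v ∉ S)
  have hcov : C ⊆ ⋃ S, U S := by
    intro x _
    have hx : {v | ¬ x v ∈ v.adicCompletionIntegers k}.Finite := Filter.eventually_cofinite.1 x.2
    refine Set.mem_iUnion.2 ⟨hx.toFinset, fun v hv => ?_⟩
    by_contra h
    exact hv (hx.mem_toFinset.2 h)
  obtain ⟨t, ht⟩ := hC.elim_finite_subcover U hUo hcov
  refine ⟨t.biUnion id, fun x hx v hv => ?_⟩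
  obtain ⟨S, hSt, hxS⟩ := Set.mem_iUnion₂.1 (ht hx)
  exact hxS v (fun hvS => hv (Finset.mem_biUnion.2 ⟨S, hSt, hvS⟩))

/-- the finite component of a row vector is continuous -/
theorem continuous_finVec (v : HeightOneSpectrum (𝓞 k)) : Continuous (finVec (k := k) v) :=
  continuous_pi fun i =>
    (RestrictedProduct.continuous_eval (R := fun v : HeightOneSpectrum (𝓞 k) => v.adicCompletion k)
      (A := fun v => (v.adicCompletionIntegers k : Set (v.adicCompletion k))) v).comp
      (continuous_snd.comp (continuous_apply i))

/-- the infinite component of a row vector is continuous -/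
theorem continuous_infVec (w : InfinitePlace k) : Continuous (infVec (k := k) w) :=
  continuous_pi fun i => (continuous_apply w).comp (continuous_fst.comp (continuous_apply i))

/-- **(C7.3a) COMPACT ⊆ BOX**: every compact `C₀ ⊆ 𝔸_k⁴` lies in a box `∏_{w} C_w × ∏_{v ∈ S} C_v × ∏_{v ∉ S} 𝓞_v⁴`
with `S` finite and every `C_w`, `C_v` compact (statement = t4-L1-p4's `C7-rungs-sig.lean` L151–L163). -/
theorem exists_finset_subset_box {C₀ : Set (Fin 4 → Ad k)} (hC₀ : IsCompact C₀) :
    ∃ S : Finset (HeightOneSpectrum (𝓞 k)),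
      ∃ Cf : ∀ v : HeightOneSpectrum (𝓞 k), Set (Fin 4 → v.adicCompletion k),
        ∃ Ci : ∀ w : InfinitePlace k, Set (Fin 4 → w.Completion),
          (∀ v ∈ S, IsCompact (Cf v)) ∧ (∀ w, IsCompact (Ci w)) ∧
            ∀ x ∈ C₀, (∀ w, infVec w x ∈ Ci w) ∧ (∀ v ∈ S, finVec v x ∈ Cf v) ∧
              ∀ v ∉ S, ∀ i, (x i).2 v ∈ v.adicCompletionIntegers k := by
  classical
  -- the four coordinate projections to the finite adeles are compact
  have hK : ∀ i : Fin 4, IsCompact ((fun x : Fin 4 → Ad k => (x i).2) '' C₀) :=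
    fun i => hC₀.image (continuous_snd.comp (continuous_apply i))
  choose S hS using fun i => exists_finset_forall_mem_integers_of_isCompact (hK i)
  refine ⟨Finset.univ.biUnion S, fun v => finVec v '' C₀, fun w => infVec w '' C₀,
    fun v _ => hC₀.image (continuous_finVec v), fun w => hC₀.image (continuous_infVec w),
    fun x hx => ⟨fun w => ⟨x, hx, rfl⟩, fun v _ => ⟨x, hx, rfl⟩, fun v hv i => ?_⟩⟩
  have hvi : v ∉ S i := fun h => hv (Finset.mem_biUnion.2 ⟨i, Finset.mem_univ i, h⟩)
  exact hS i ((x i).2) ⟨x, hx, rfl⟩ v hvi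

end CompactBox

end Summit.Ventures.HodgeRepro.Tier4.Line1

end
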